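import Mathlib
import Literature.Geometry.Lorentzian.GiorgiKlainermanSzeftel2022.GRWTransformationAlgebra
import Literature.Geometry.Lorentzian.GiorgiKlainermanSzeftel2022.TeukolskyQfbLedger

/-!
# Giorgi–Klainerman–Szeftel — App. D.8.1 ledger: the quantities `𝒜₁, 𝒜₂, 𝒜₃, 𝒜₄, ℬ` of the Teukolsky–Starobinski identity and their `ᶜ∇₄`-derivatives (Definition D.8.1, Lemmas D.8.2–D.8.5)

Sources, read side by side (the loci of both are given in every docstring):

* `[J]`  E. Giorgi, S. Klainerman, J. Szeftel, *Wave equations estimates and the nonlinear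
  stability of slowly rotating Kerr black holes*, Pure Appl. Math. Q. **20** (2024), no. 7
  (doi:10.4310/pamq.241128023033) — Proposition 5.4.1 (Teukolsky–Starobinski, file p0204 L34) is proved
  in Appendix D.8 "Proof of Proposition 5.4.1"; this module types its §D.8.1 "Preliminaries":
  Definition D.8.1 (file p0898 L36–58), Lemma D.8.2 (p0898 L61 – p0899 L33, proof p0899 L35 –
  p0900 L168), Lemma D.8.3 (p0901 L5–17, proof L18–110), Lemma D.8.4 (p0901 L111–135, proof p0902 L5
  – p0905 L99) and Lemma D.8.5 (p0905 L100 – p0906 L31, proof p0906 L32 – p0908 L117).  "file pNNNN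
  Lm" = page NNNN of the journal PDF (folio NNNN−1), line m of its text layer;
* `[v1]` the same authors and title, arXiv:2205.14808v1 (2022), TeX source: section
  `proof:teukolsky-starobinski`, subsection "Preliminaries" l.36539–36904 — the definition
  l.36549–36560, Lemma `derivatives-AA1` l.36565–36622, Lemma `DDcAA3` l.36627–36658, Lemma
  `nabc4AA4` l.36661–36790, Lemma `derivatives-nabc4-BB` l.36793–36904.

The two texts agree on every statement and display typed here (collation in the cell's
DIVERGENCE ledger); the cosmetic slips `ℬ₁` for `ℬ` (`[v1]` l.36613, 36841, 36872, 36882, 36893,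
36895 = `[J]` p0900 L97, p0907 L19, p0908 L5, L40, L76, L82), `F̄` for `B̄` in the displayed
commutator (`[v1]` l.36816 = `[J]` p0906 L46) and the missing `+` before `(𝒟 + H̲)⊗̂[…]` in the third
identity of Lemma D.8.5 (`[v1]` l.36805, 36900 = `[J]` p0906 L19, p0908 L113) are common to both and
are read through.

## What is transcribed

Definition D.8.1: "`𝒜₁ = 𝒟P + 3PH̲`, `𝒜₂ = 𝒟⊗̂H̲ + H̲⊗̂H̲`, `𝒜₃ = 2ᶜ∇₄H̲ − 𝒟(tr X)`,
`𝒜₄ = 𝒟⊗̂𝒟(tr X) + 3H̲⊗̂𝒟(tr X)`, `ℬ = 𝒟·B̄ + 2H̲·B̄`" (they enter every theorem as the defining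
hypotheses `hA1 … hA4`, `hbb`), and the four lemmas "modulo quadratic terms":
* D.8.2: `ᶜ∇₄𝒜₁ = −2tr X 𝒜₁ + ½𝒟ℬ + 2H̲ℬ + (3/2)P(H̄·X̂ − conj(tr X̲)Ξ + 𝒜₃)` and
  `ᶜ∇₄𝒟⊗̂𝒜₁ = −(5/2)tr X 𝒟⊗̂𝒜₁ + (3/2)tr X H̲⊗̂𝒜₁ + ½𝒟⊗̂𝒟ℬ + (5/2)H̲⊗̂𝒟ℬ + (𝒟⊗̂ + H̲⊗̂)((3/2)P(…))`
  (§1: `D82_nab4_A1`, `D82_nab4_Dhat_A1`, `D82_nab4_Dhat_A1_printed`);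
* D.8.3: `𝒟⊗̂𝒜₃ − 2ᶜ∇₄𝒜₂ = tr X 𝒜₂ − 3H̲⊗̂𝒜₃ − 𝒜₄ + 2B⊗̂H̲ + (tr X̲ + conj tr X̲)H̲⊗̂Ξ
  − conj(tr X̲)H⊗̂Ξ + X̂·conj𝒟H̲ − X̂(H̲̄·H̲)` (§2: `D83`);
* D.8.4: `ᶜ∇₄𝒜₄ = −2tr X 𝒜₄ − 3tr X H̲⊗̂𝒜₃ − tr X 𝒟⊗̂B + 2tr X H̲⊗̂B + 𝓜[Ξ]
  − ½(conj tr X − tr X)𝒟⊗̂(X̂·H̄) + ½tr X 𝒟⊗̂(X̂·H̲̄) − ½(tr X − conj tr X)(H·H̄)X̂ + tr X(H̲·H̲̄)X̂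
  + tr X H̲⊗̂(X̂·H̄) + X̂·conj𝒟(tr X H̲)`, "where `𝓜[Ξ]` only depends on `Ξ`" (§3: the seven
  displayed steps `D84_expand`, `D84_comm_trX`, `D84_comm_trX_simplified`, `D84_comm_DtrX`,
  `D84_collect`, `D84_DD4`, `D84_Dhat_comm`, and the assembly `D84_final`, in which `𝓜[Ξ]` — never
  spelled out in print — is the EXPLICIT sum `hM` of the kernel's `Ξ`-carrying terms);
* D.8.5: the three identities for `ᶜ∇₄ℬ`, `ᶜ∇₄𝒟ℬ`, `ᶜ∇₄𝒟⊗̂𝒟ℬ` (§4: `D85_nab4_B`, `D85_nab4_DB`,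
  `D85_nab4_DhatDB`).

## How it is typed (the model and its limits)

The same scalar–module shadow as the sibling ledgers of App. D.3/D.6/D.7 (`TeukolskyAbarLedger`,
`TeukolskyAbarWaveLedger`, `TeukolskyQfbLedger`), whose `CovD` (an additive operator with the Leibniz
rule against a scalar derivation — the only property of `ᶜ∇₄` the displays use) and `Dv_ofNat` are imported
by name.
Scalars live in a field `K` (`CharZero` where printed fractions are cleared): `x = tr X`,
`xc = conj tr X`, `xb = tr X̲`, `xbc = conj tr X̲`, `p = P`, `bb = ℬ`, and opaque scalars for the
products the text keeps whole (`divBc = 𝒟·B̄`, `HbBc = H̲·B̄`, `hh = H̲·H̲̄ = H̲̄·H̲`, `HHc = H·H̄`,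
`divXic = 𝒟·Ξ̄`, `XiHc = Ξ·H̄`, `XicH = Ξ̄·H`, `divHc = 𝒟·H̄`, …).  One-forms (`𝔰₁(ℂ)`) live in a
`K`-module `M₁` (`Hb = H̲`, `H`, `Hc = H̄`, `Hbc = H̲̄`, `Xi = Ξ`, `Xic = Ξ̄`, `B`, `Bc = B̄`, `F = 𝒟tr X`,
`A1 = 𝒜₁`, `A3 = 𝒜₃`, …), symmetric traceless 2-tensors (`𝔰₂(ℂ)`) in `M₂` (`Xh = X̂`, `A2`, `A4`, …).
`ᶜ∇₄` on scalars is `D4 : Derivation ℤ K K`, on `M₁`/`M₂` a `CovD D4`; `𝒟` on scalars is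
`Dc : Derivation ℤ K M₁`; `𝒟⊗̂` is an additive `Dhat : M₁ →+ M₂` with the Leibniz rule
`Dhat (f•u) = f•Dhat u + (𝒟f)⊗̂u` (`hDL`, `[J]` Lemma 2.4.6 = `[v1]` (DD-hot-hF)); `𝒟·` on one-forms an
additive `Ddot : M₁ →+ K` with `Ddot (f•u) = f Ddot u + 𝒟f·u` (`hDdL`, ibid. (ov-HH-hF) conjugated);
`⊗̂` a bilinear `hot`, `X̂·` a linear `Xc : M₁ →ₗ M₁`, `H̲̄·` a linear `dHbc : M₁ →ₗ K`, one-form pairings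
a bilinear `pair`; `F ↦ X̂·conj𝒟F` and `F ↦ ᶜ∇₃F` (never expanded by the text) additive maps `XDb`, `n3`.
Where the text uses the symmetry of `⊗̂` silently, the needed instance is a named hypothesis (`hs…`).

CONVENTION FOR "MODULO QUADRATIC TERMS".  Every quoted identity enters EXACTLY AS THE PROOF DISPLAYS
IT, as a hypothesis on the operator values: the commutators of `[J]` Lemma 4.2.2 in the displayed
instances ((4.2.9) `h = P, s = 0`, and the `s = 1`, `h = tr X` instance quoted without number; (4.2.10) `h = ℬ, s = 1`; (4.2.12) `F = H̲, s = 0`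
and `F = 𝒟tr X, s = 1`; (4.2.13) `F = 𝒜₁, s = 0` and `F = 𝒟ℬ, s = 1`; (4.2.16) `F = B, s = 1`) — the
"err" versions (4.2.10), (4.2.13), (4.2.16) with an opaque remainder `g…`; the Bianchi identities for
`ᶜ∇₄P`, `ᶜ∇₄B̄` and the null-structure equations for `ᶜ∇₄tr X`, `ᶜ∇₃tr X` as displayed (`[v1]`
l.36587, 36824, 36692, 36736).  Every BACKGROUND ("`+ O(ε)`") substitution the proof makes inside a
product — `conj𝒟P = −3PH̄`, `ᶜ∇₃P = −(3/2)conj(tr X̲)P`, `𝒟tr X = −2tr X H̲`, `𝒟conj tr X = (tr X −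
conj tr X)H`, `ᶜ∇₃H̲ = −½conj(tr X̲)(H̲ − H)`, `conj(tr X)H̄ = −tr X H̲̄`, `ᶜ∇₄H̲ = −tr X H̲`, `𝒟P = −3H̲P`,
`(𝒟H̲)·B̄ = −H̲(H̲·B̄)`, `𝒟⊗̂H̲ = −H̲⊗̂H̲ + 𝒜₂` — enters with an OPAQUE first-order remainder (`gx`, `g₃`,
`gP`, …), so that the defined `O(ε)` quantities are not forced to degenerate (entering `𝒟P = −3H̲P`
and `ᶜ∇₄H̲ = −tr X H̲` exactly would make `𝒜₁ = 𝒜₃ = 0`); each conclusion is then the PRINTED right-hand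
side `+` an explicit sum of the dropped products (last bracket of each statement), i.e. the kernel
exhibits exactly which quadratic terms "modulo quadratic terms" stands for — including the term
`2ℬ𝒜₂` of the second identity of D.8.2 and the `Ξ`-free products hidden in `𝓜[Ξ]`'s companions.

## Certified here (16 theorems, 0 `sorry`, 0 new definitions)

Every displayed equality of `[J]` pp. 897–907 (`[v1]` l.36549–36904) is an identity of the model
with the coefficients AS PRINTED, with one parametrised exception:

PRINT DATUM OFFERED TO THE CENSUS (not a ruling).  Three steps of the proof of Lemma D.8.4 collapse
`(X̂·H̲̄)⊗̂H̲`, `H̲⊗̂(X̂·H̲̄)` and `H⊗̂(X̂·H̄)` to scalar multiples of `X̂` (`[v1]` l.36718→36721 "`−2tr X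
(H̲·H̲̄)X̂`", l.36772–36777 "`+ tr X(H̲·H̲̄)X̂`", "`−½(tr X − conj tr X)(H·H̄)X̂`" = `[J]` p0903 L60–75,
p0905 L5–99).  The kernel carries the collapse as the hypothesis `E⊗̂(Ē·X̂) = c (E·Ē) X̂` with a free
coefficient `c` (`hcol`, `hcol1`, `hcol2`) and proves the displays with the coefficients
`(1 + c) tr X`, `(2c − 1) tr X`, `½(tr X − conj tr X)·c` in place of the printed `2tr X`, `tr X`, `½(tr X −
conj tr X)`: the printed statement of Lemma D.8.4 is the case `c = 1`, which is also how both texts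
paraphrase `[J]` (2.4.2) later in App. D.8 ("Using (2.4.2), i.e. `H̲⊗̂(H̄·X̂) + H⊗̂(H̲̄·X̂) = (H̲·H̄ +
H̲̄·H)X̂`", `[J]` p0924 L10 = `[v1]` l.37434), whereas `[J]` Lemma 2.4.5 (2.4.2) as printed and proved
(`[J]` p0111 L35 – p0112 L12 = `[v1]` l.4928–4967, "`E⊗̂(F̄·U) + F⊗̂(Ē·U) = 2(E·F̄ + Ē·F)U`") gives
`c = 2`.  Which reading is the authors' is for the census (the affected terms are linear in `X̂ ∈ Γ_g`
with `O(1)` coefficients; their fate is decided in §D.8.2, not typed here); the kernel records both.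

READING NOTES (no effect on any display): (1) the display `[v1]` l.36755–36758 (= `[J]` p0904 L49–83) of
`𝒟⊗̂([ᶜ∇₄,𝒟]tr X)` omits the `Ξ`-carrying terms `𝒟⊗̂((𝒟·Ξ̄ + Ξ·H̄ + Ξ̄·H)H̲) + 𝒟⊗̂((…)Ξ)`, which the
text collects into `𝓜[Ξ]` only at the next step — the kernel carries them (`D84_Dhat_comm`); (2) that
display differentiates the UNSIMPLIFIED form of the commutator (`[v1]` l.36689–36691) while
`4H̲⊗̂[ᶜ∇₄,𝒟]tr X` uses the simplified one (l.36701–36704); the two differ by `−½X̂·(conj(tr X)H̄ +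
tr X H̲̄)`, a quadratic term the kernel keeps in the remainder `q0` (`D84_comm_trX_simplified`); (3) the
text expands `𝒟(Ξ·H̄)`, `𝒟(Ξ̄·H)` by Leibniz inside `𝓜[Ξ]` (l.36740–36741); the kernel keeps `𝒟(Ξ·H̄)`,
`𝒟(Ξ̄·H)` whole (`Dc XiHc`, `Dc XicH`), which changes nothing outside `𝓜[Ξ]`.

## Not claimed

Nothing here is analysis or geometry: `K`, `M₁`, `M₂` are abstract, the operators are abstract
additive/derivation data constrained only by the displayed identities, the decay classes `Γ_g, Γ_b`,
`O(ε)`, `r⁻ᵏ𝔡^{≤j}` and every absorption into them are outside the model and appear in docstrings only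
as the text's words; Lemma 4.2.2, Lemma 2.4.5/2.4.6, the Bianchi and null-structure identities are
HYPOTHESES in the displayed instances, not theorems; Proposition 5.4.1 itself and §D.8.2 (Lemmas
D.8.6–D.8.9, the derivation of the identity) are not typed here.  Nothing here is a hypothesis-fact
of `[J]`; no `def … : Prop`.  This module is a typed reading aid for the cell's census of `[J]` ch. 5 /
App. D, not progress on any summit.
-/

namespace Literature.Geometry.Lorentzian.GiorgiKlainermanSzeftel2022.TeukolskyStarobinskiPrelimLedger

open Literature.Geometry.Lorentzian.GiorgiKlainermanSzeftel2022.GRWTransformationAlgebra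
open Literature.Geometry.Lorentzian.GiorgiKlainermanSzeftel2022.TeukolskyQfbLedger (Dv_ofNat)

variable {K : Type*} [Field K]

/-! ## §0 Helpers; the cast of Definition D.8.1

Definition D.8.1 (`[J]` p0898 L36–58 = `[v1]` l.36549–36560): "`𝒜₁ = 𝒟P + 3PH̲ ∈ 𝔰₁(ℂ)`,
`𝒜₂ = 𝒟⊗̂H̲ + H̲⊗̂H̲ ∈ 𝔰₂(ℂ)`, `𝒜₃ = 2ᶜ∇₄(H̲) − 𝒟(tr X) ∈ 𝔰₁(ℂ)`, `𝒜₄ = 𝒟⊗̂𝒟(tr X) + 3H̲⊗̂𝒟(tr X) ∈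
𝔰₂(ℂ)`.  We also define `ℬ = 𝒟·B̄ + 2H̲·B̄ ∈ 𝔰₀`."  In the model: `hA1 : A1 = Dc p + (3p)•Hb`,
`hA2 : A2 = Dhat Hb + hot Hb Hb`, `hA3 : A3 = 2•ᶜ∇₄Hb − Dc x`, `hA4 : A4 = Dhat F + 3•hot Hb F` with
`F = Dc x = 𝒟tr X`, `hbb : bb = divBc + 2 HbBc` (or `= Ddot Bc + 2 pair Hb Bc`). -/

/-- The numerals and numeral quotients met below are killed by any derivation (used for `𝒟` acting
on scalars, and for `ᶜ∇₄` on scalars with `M = K`; `Dv_ofNat` is the sibling ledger's). [folklore] -/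
theorem Dm_num {M : Type*} [AddCommGroup M] [Module K M] (Dh : Derivation ℤ K M) :
    Dh (2 : K) = 0 ∧ Dh (3 : K) = 0 ∧ Dh (4 : K) = 0 ∧ Dh (5 : K) = 0 ∧ Dh ((1 : K) / 2) = 0 ∧
    Dh ((3 : K) / 2) = 0 ∧ Dh ((5 : K) / 2) = 0 := by
  have h2 : Dh (2 : K) = 0 := Dv_ofNat Dh 2
  refine ⟨h2, Dv_ofNat Dh 3, Dv_ofNat Dh 4, Dv_ofNat Dh 5, ?_, ?_, ?_⟩
  · rw [Dh.leibniz_div_const _ _ h2, Dh.map_one_eq_zero, smul_zero]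
  · rw [Dh.leibniz_div_const _ _ h2, Dv_ofNat Dh 3, smul_zero]
  · rw [Dh.leibniz_div_const _ _ h2, Dv_ofNat Dh 5, smul_zero]

variable {M₁ M₂ : Type*} [AddCommGroup M₁] [Module K M₁] [AddCommGroup M₂] [Module K M₂]

/-! ## §1 Lemma D.8.2 (`[v1]` Lemma `derivatives-AA1`) -/

/-- Lemma D.8.2, first identity, EXACT.  Entering: "Applying Lemma 4.2.2, (4.2.9), to `h = P` and
`s = 0`: `[ᶜ∇₄, 𝒟]P = −½tr X 𝒟P + H̲ ᶜ∇₄P − ½X̂·conj𝒟P + Ξ ᶜ∇₃P`" (`hcomm`), the Bianchi identity as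
used "`ᶜ∇₄P = −(3/2)tr X P + ½𝒟·B̄ + H̲·B̄`" (`hBP`), the background relations "`conj𝒟P = −3PH̄ + O(ε)`"
(`hDbP`, remainder `gPb`) and `ᶜ∇₃P = −(3/2)conj(tr X̲)P + …` (`h3P`, remainder `e3`; the text writes
the product directly as "`−(3/2)conj(tr X̲)PΞ`"), the definitions of `𝒜₁, 𝒜₃, ℬ`.  Conclusion = the
displayed chain `ᶜ∇₄𝒜₁ = 𝒟ᶜ∇₄P + [ᶜ∇₄,𝒟]P + 3ᶜ∇₄(P)H̲ + 3Pᶜ∇₄(H̲) = … = −2tr X 𝒜₁ + 𝒟(½𝒟·B̄ + H̲·B̄)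
+ 4H̲(½𝒟·B̄ + H̲·B̄) + 3(ᶜ∇₄H̲ − ½𝒟tr X)P + (3/2)PH̄·X̂ − (3/2)conj(tr X̲)PΞ`" and its printed end form
"`ᶜ∇₄𝒜₁ = −2tr X 𝒜₁ + ½𝒟ℬ + 2H̲ℬ + (3/2)P(H̄·X̂ − conj(tr X̲)Ξ + 𝒜₃)`", `+` the dropped products
`e3 Ξ − ½X̂·gPb`.
[cite: GiorgiKlainermanSzeftel2024, p0898 L61–72, p0899 L35 – p0900 L36; GiorgiKlainermanSzeftel2022, l.36565–36568, l.36576–36599] -/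
theorem D82_nab4_A1 [CharZero K] {D4 : Derivation ℤ K K} (N4 : CovD D4 M₁) (Dc : Derivation ℤ K M₁)
    (Xc : M₁ →ₗ[K] M₁) (x xbc p divBc HbBc bb n3p e3 : K) (A1 A3 Hb Hc Xi DbP gPb : M₁)
    (hA1 : A1 = Dc p + (3 * p) • Hb) (hA3 : A3 = (2 : K) • N4.op Hb - Dc x)
    (hbb : bb = divBc + 2 * HbBc)
    (hcomm : N4.op (Dc p) = Dc (D4 p) - (1 / 2 * x) • Dc p + D4 p • Hb - (1 / 2 : K) • Xc DbP
      + n3p • Xi)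
    (hBP : D4 p = -(3 / 2) * (x * p) + 1 / 2 * divBc + HbBc)
    (h3P : n3p = -(3 / 2) * (xbc * p) + e3) (hDbP : DbP = -((3 * p) • Hc) + gPb) :
    N4.op A1 = -((2 * x) • A1) + (1 / 2 : K) • Dc bb + (2 * bb) • Hb
      + (3 / 2 * p) • (Xc Hc - xbc • Xi + A3) + (e3 • Xi - (1 / 2 : K) • Xc gPb) := by
  obtain ⟨h2, -, -, -, h12, h32, -⟩ := Dm_num Dc
  obtain ⟨-, e3', -, -, -, -, -⟩ := Dm_num D4
  subst hA1 hA3 hbb h3P hDbP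
  rw [map_add, N4.leibniz, hcomm]
  simp only [hBP, map_add, map_neg, map_smul, Dc.leibniz, D4.leibniz, h2, h12, h32,
    e3', smul_zero, add_zero, smul_eq_mul, mul_zero, neg_zero, smul_add, smul_sub]
  module

/-- Lemma D.8.2, second identity, EXACT kernel form (the last display of the proof, before the two
background substitutions).  Entering: "we apply Lemma 4.2.2, (4.2.13), to `F = 𝒜₁` and `s = 0`:
`[ᶜ∇₄, 𝒟⊗̂]𝒜₁ = −½tr X(𝒟⊗̂𝒜₁ + H̲⊗̂𝒜₁) + H̲⊗̂ᶜ∇₄𝒜₁`" (`hcomm`, err-version remainder `g₄`), the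
first identity with its bracket `(3/2)P(H̄·X̂ − conj(tr X̲)Ξ + 𝒜₃)` abbreviated `T` (`hi`), the Leibniz
rule of `𝒟⊗̂` (`hDL`), the definition of `𝒜₂`, and the symmetry instance `𝒟ℬ⊗̂H̲ = H̲⊗̂𝒟ℬ` (`hsym`)
the text uses silently.  Conclusion, as displayed: "`ᶜ∇₄𝒟⊗̂𝒜₁ = −(5/2)tr X 𝒟⊗̂𝒜₁ − (2𝒟tr X +
(5/2)tr X H̲)⊗̂𝒜₁ + ½𝒟⊗̂𝒟ℬ + (5/2)H̲⊗̂𝒟ℬ + 2(𝒟⊗̂H̲ + H̲⊗̂H̲)ℬ + 𝒟⊗̂(T) + H̲⊗̂(T)`" (`+ g₄`).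
[cite: GiorgiKlainermanSzeftel2024, p0900 L37–165; GiorgiKlainermanSzeftel2022, l.36602–36620] -/
theorem D82_nab4_Dhat_A1 [CharZero K] {D4 : Derivation ℤ K K} (N4 : CovD D4 M₁) (N4' : CovD D4 M₂)
    (Dc : Derivation ℤ K M₁) (hot : M₁ →ₗ[K] M₁ →ₗ[K] M₂) (Dhat : M₁ →+ M₂)
    (x bb : K) (A1 Hb T : M₁) (A2 g₄ : M₂)
    (hDL : ∀ (f : K) (u : M₁), Dhat (f • u) = f • Dhat u + hot (Dc f) u)
    (hA2 : A2 = Dhat Hb + hot Hb Hb)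
    (hcomm : N4'.op (Dhat A1) = Dhat (N4.op A1) - (1 / 2 * x) • (Dhat A1 + hot Hb A1)
      + hot Hb (N4.op A1) + g₄)
    (hi : N4.op A1 = -((2 * x) • A1) + (1 / 2 : K) • Dc bb + (2 * bb) • Hb + T)
    (hsym : hot (Dc bb) Hb = hot Hb (Dc bb)) :
    N4'.op (Dhat A1) = -((5 / 2 * x) • Dhat A1) - hot ((2 : K) • Dc x + (5 / 2 * x) • Hb) A1
      + (1 / 2 : K) • Dhat (Dc bb) + (5 / 2 : K) • hot Hb (Dc bb) + (2 * bb) • A2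
      + (Dhat T + hot Hb T) + g₄ := by
  obtain ⟨h2, -, -, -, h12, -, -⟩ := Dm_num Dc
  subst hA2
  rw [hcomm, hi]
  simp only [map_add, map_neg, hDL, map_smul, Dc.leibniz, h2, h12, smul_zero, add_zero,
    map_zero, LinearMap.zero_apply, LinearMap.add_apply, LinearMap.smul_apply, hsym, smul_add]
  module

/-- Lemma D.8.2, second identity, PRINTED form: "In view of `𝒟⊗̂H̲ + H̲⊗̂H̲ = O(ε)` and `𝒟(tr X) =
−2tr X H̲ + O(ε)` we obtain the stated", i.e. from the exact form (`hN`, with `F = 𝒟tr X`, `Dbb = 𝒟ℬ`)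
and `𝒟tr X = −2tr X H̲ + gx` (`hF`): "`ᶜ∇₄𝒟⊗̂𝒜₁ = −(5/2)tr X 𝒟⊗̂𝒜₁ + (3/2)tr X H̲⊗̂𝒜₁ + ½𝒟⊗̂𝒟ℬ +
(5/2)H̲⊗̂𝒟ℬ + 𝒟⊗̂(T) + H̲⊗̂(T)`" `+` the dropped `2ℬ𝒜₂ − 2gx⊗̂𝒜₁ + g₄` (`−(5/2) + 4 = 3/2`).
[cite: GiorgiKlainermanSzeftel2024, p0899 L5–33, p0900 L166–168; GiorgiKlainermanSzeftel2022, l.36569–36574, l.36621] -/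
theorem D82_nab4_Dhat_A1_printed [CharZero K] (hot : M₁ →ₗ[K] M₁ →ₗ[K] M₂) (Dhat : M₁ →+ M₂)
    (x bb : K) (A1 Hb T F Dbb gx : M₁) (A2 g₄ N : M₂)
    (hN : N = -((5 / 2 * x) • Dhat A1) - hot ((2 : K) • F + (5 / 2 * x) • Hb) A1
      + (1 / 2 : K) • Dhat Dbb + (5 / 2 : K) • hot Hb Dbb + (2 * bb) • A2 + (Dhat T + hot Hb T) + g₄)
    (hF : F = -((2 * x) • Hb) + gx) :
    N = -((5 / 2 * x) • Dhat A1) + (3 / 2 * x) • hot Hb A1 + (1 / 2 : K) • Dhat Dbb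
      + (5 / 2 : K) • hot Hb Dbb + (Dhat T + hot Hb T)
      + ((2 * bb) • A2 - (2 : K) • hot gx A1 + g₄) := by
  subst hN hF
  simp only [map_add, map_neg, map_smul, LinearMap.add_apply, LinearMap.smul_apply, LinearMap.neg_apply]
  module

/-! ## §2 Lemma D.8.3 (`[v1]` Lemma `DDcAA3`) -/

/-- Lemma D.8.3, EXACT.  Entering: the definitions of `𝒜₂, 𝒜₃, 𝒜₄`; the product rule
`ᶜ∇₄(H̲⊗̂H̲) = ᶜ∇₄H̲⊗̂H̲ + H̲⊗̂ᶜ∇₄H̲` (`hprod`); "Applying Lemma 4.2.2, (4.2.12), to `F = H̲` and `s = 0`: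
`[ᶜ∇₄, 𝒟⊗̂]H̲ = −½tr X(𝒟⊗̂H̲ + H̲⊗̂H̲) + H̲⊗̂ᶜ∇₄H̲ + Ξ⊗̂ᶜ∇₃H̲ − B⊗̂H̲ − ½tr X̲ Ξ⊗̂H̲ − ½X̂·conj𝒟H̲ +
½X̂(H̲̄·H̲)`" (`hcomm`; `XhDbHb = X̂·conj𝒟H̲`, `hh = H̲̄·H̲`), "`ᶜ∇₃H̲ = −½conj(tr X̲)(H̲ − H) + O(ε)`"
(`h3`, remainder `g₃`), and the symmetry instances the text uses silently (`hs1–hs3`).  Conclusion =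
the displayed chain "`𝒟⊗̂𝒜₃ − 2ᶜ∇₄𝒜₂ = 2[𝒟⊗̂, ᶜ∇₄]H̲ − 𝒟⊗̂𝒟tr X − 4ᶜ∇₄H̲⊗̂H̲ = … = tr X 𝒜₂ − 6H̲⊗̂ᶜ∇₄H̲
+ 2B⊗̂H̲ − 𝒟⊗̂𝒟tr X + (tr X̲ + conj tr X̲)H̲⊗̂Ξ − conj(tr X̲)H⊗̂Ξ + X̂·conj𝒟H̲ − X̂(H̲̄·H̲)`", then
"writing `2ᶜ∇₄H̲ = 𝒜₃ + 𝒟tr X`" and "recalling the definition of `𝒜₄`": the printed statement, `+` the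
dropped `−2Ξ⊗̂g₃`.
[cite: GiorgiKlainermanSzeftel2024, p0901 L5–110; GiorgiKlainermanSzeftel2022, l.36627–36657] -/
theorem D83 [CharZero K] {D4 : Derivation ℤ K K} (N4 : CovD D4 M₁) (N4' : CovD D4 M₂)
    (Dc : Derivation ℤ K M₁) (hot : M₁ →ₗ[K] M₁ →ₗ[K] M₂) (Dhat : M₁ →+ M₂)
    (x xb xbc hh : K) (Hb H Xi B n3Hb g₃ A3 : M₁) (A2 A4 XhDbHb Xh : M₂)
    (hDL : ∀ (f : K) (u : M₁), Dhat (f • u) = f • Dhat u + hot (Dc f) u)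
    (hA2 : A2 = Dhat Hb + hot Hb Hb) (hA3 : A3 = (2 : K) • N4.op Hb - Dc x)
    (hA4 : A4 = Dhat (Dc x) + (3 : K) • hot Hb (Dc x))
    (hprod : N4'.op (hot Hb Hb) = hot (N4.op Hb) Hb + hot Hb (N4.op Hb))
    (hcomm : N4'.op (Dhat Hb) = Dhat (N4.op Hb) - (1 / 2 * x) • (Dhat Hb + hot Hb Hb)
      + hot Hb (N4.op Hb) + hot Xi n3Hb - hot B Hb - (1 / 2 * xb) • hot Xi Hb - (1 / 2 : K) • XhDbHb
      + (1 / 2 * hh) • Xh)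
    (h3 : n3Hb = -((1 / 2 * xbc) • (Hb - H)) + g₃)
    (hs1 : hot (N4.op Hb) Hb = hot Hb (N4.op Hb)) (hs2 : hot Xi Hb = hot Hb Xi)
    (hs3 : hot Xi H = hot H Xi) :
    Dhat A3 - (2 : K) • N4'.op A2 = x • A2 - (3 : K) • hot Hb A3 - A4 + (2 : K) • hot B Hb
      + (xb + xbc) • hot Hb Xi - xbc • hot H Xi + XhDbHb - hh • Xh - (2 : K) • hot Xi g₃ := by
  obtain ⟨h2, -, -, -, -, -, -⟩ := Dm_num Dc
  subst hA2 hA3 hA4 h3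
  rw [map_add N4'.op, hcomm, hprod]
  simp only [map_add, map_sub, map_neg, map_smul, hDL, h2, map_zero, LinearMap.zero_apply,
    add_zero, smul_add, smul_sub, smul_neg, hs1, hs2, hs3]
  module

/-! ## §3 Lemma D.8.4 (`[v1]` Lemma `nabc4AA4`)

The proof is typed display by display: (a) `D84_expand`, (b) `D84_comm_trX` and
`D84_comm_trX_simplified` (the commutator `[ᶜ∇₄, 𝒟]tr X`), (c) `D84_comm_DtrX` (the commutator
`[ᶜ∇₄, 𝒟⊗̂]𝒟tr X`), (d) `D84_collect` ("We therefore obtain"), (e) `D84_DD4` (`𝒟ᶜ∇₄tr X`,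
`𝒟⊗̂𝒟ᶜ∇₄tr X`), (f) `D84_Dhat_comm` (`𝒟⊗̂[ᶜ∇₄, 𝒟]tr X`), (g) `D84_final` ("We finally put all
together").  Throughout `F = 𝒟tr X`, `C0 = [ᶜ∇₄, 𝒟]tr X` (i.e. `ᶜ∇₄𝒟tr X = 𝒟ᶜ∇₄tr X + C0`),
`C1 = [ᶜ∇₄, 𝒟⊗̂]𝒟tr X`. -/

/-- (a) "Recalling the definition of `𝒜₄`: `ᶜ∇₄𝒜₄ = 𝒟⊗̂ᶜ∇₄𝒟(tr X) + [ᶜ∇₄, 𝒟⊗̂]𝒟(tr X) +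
3ᶜ∇₄H̲⊗̂𝒟(tr X) + 3H̲⊗̂ᶜ∇₄𝒟(tr X) = 𝒟⊗̂𝒟(ᶜ∇₄tr X) + 𝒟⊗̂([ᶜ∇₄, 𝒟]tr X) + [ᶜ∇₄, 𝒟⊗̂]𝒟(tr X) +
3ᶜ∇₄H̲⊗̂𝒟(tr X) + 3H̲⊗̂𝒟(ᶜ∇₄tr X) + 3H̲⊗̂[ᶜ∇₄, 𝒟](tr X)`" — from the definitions of the two
commutators (`hC0`, `hC1`; `F` is `𝒟tr X`) and the product rule (`hprod`).
[cite: GiorgiKlainermanSzeftel2024, p0902 L5–32; GiorgiKlainermanSzeftel2022, l.36671–36679] -/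
theorem D84_expand [CharZero K] {D4 : Derivation ℤ K K} (N4 : CovD D4 M₁) (N4' : CovD D4 M₂)
    (Dc : Derivation ℤ K M₁) (hot : M₁ →ₗ[K] M₁ →ₗ[K] M₂) (Dhat : M₁ →+ M₂) (x : K)
    (Hb F C0 : M₁) (A4 C1 : M₂)
    (hA4 : A4 = Dhat F + (3 : K) • hot Hb F)
    (hC0 : N4.op F = Dc (D4 x) + C0) (hC1 : N4'.op (Dhat F) = Dhat (N4.op F) + C1)
    (hprod : N4'.op (hot Hb F) = hot (N4.op Hb) F + hot Hb (N4.op F)) :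
    N4'.op A4 = Dhat (Dc (D4 x)) + Dhat C0 + C1 + (3 : K) • hot (N4.op Hb) F
      + (3 : K) • hot Hb (Dc (D4 x)) + (3 : K) • hot Hb C0 := by
  obtain ⟨-, e3, -, -, -, -, -⟩ := Dm_num D4
  subst hA4
  rw [map_add, N4'.leibniz, hC1, hprod, hC0]
  simp only [map_add, e3, zero_smul, zero_add, smul_add]
  module

/-- (b) "Applying Lemma 4.2.2 to `h = tr X` and `s = 1`: `[ᶜ∇₄, 𝒟]tr X = −½tr X 𝒟tr X + H̲ᶜ∇₄tr X
− ½X̂·conj𝒟tr X + Ξᶜ∇₃tr X + (½tr X H̲ + ½X̂·H̲̄ − ½tr X̲ Ξ − B)tr X`" (`hC0`; `n4x = ᶜ∇₄tr X`,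
`n3x = ᶜ∇₃tr X`, `DbX = conj𝒟tr X`), "where we used that `ᶜ∇₃tr X + ½tr X̲ tr X = 𝒟·H̄ + H·H̄ + 2P +
O(ε²)`, `ᶜ∇₄tr X + ½(tr X)² = 𝒟·Ξ̄ + Ξ·H̄ + Ξ̄·H`" (`h3x`, `h4x`, remainders `e3`, `e4`) and the
background `conj𝒟tr X = (conj tr X − tr X)H̄ + O(ε)` read off the display (`hDbX`, remainder `gDb`):
the UNSIMPLIFIED displayed value "`= −½tr X 𝒟tr X − tr X B + H̲(𝒟·Ξ̄ + Ξ·H̄ + Ξ̄·H) + (−tr X̲ tr X +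
𝒟·H̄ + H·H̄ + 2P)Ξ − ½(conj tr X − tr X)X̂·H̄ + ½tr X X̂·H̲̄`", `+` the dropped `e4 H̲ + e3 Ξ − ½X̂·gDb`.
[cite: GiorgiKlainermanSzeftel2024, p0902 L33–86; GiorgiKlainermanSzeftel2022, l.36680–36692] -/
theorem D84_comm_trX [CharZero K] (Xc : M₁ →ₗ[K] M₁)
    (x xc xb n4x n3x divXic XiHc XicH divHc HHc p e3 e4 : K) (F Hb Hc Hbc Xi B DbX gDb C0 : M₁)
    (hC0 : C0 = -((1 / 2 * x) • F) + n4x • Hb - (1 / 2 : K) • Xc DbX + n3x • Xi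
        + x • ((1 / 2 * x) • Hb + (1 / 2 : K) • Xc Hbc - (1 / 2 * xb) • Xi - B))
    (h4x : n4x = -(1 / 2) * x ^ 2 + (divXic + XiHc + XicH) + e4)
    (h3x : n3x = -(1 / 2) * (xb * x) + (divHc + HHc + 2 * p) + e3)
    (hDbX : DbX = (xc - x) • Hc + gDb) :
    C0 = -((1 / 2 * x) • F) - x • B + (divXic + XiHc + XicH) • Hb
      + (-(xb * x) + divHc + HHc + 2 * p) • Xi
      - (1 / 2 * (xc - x)) • Xc Hc + (1 / 2 * x) • Xc Hbc
      + (e4 • Hb + e3 • Xi - (1 / 2 : K) • Xc gDb) := by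
  subst hC0 h4x h3x hDbX
  simp only [map_add, map_smul, smul_add, smul_sub]
  module

/-- (b′) "Using that `conj(tr X)H̲ + tr X H = O(ε)`, we also simplify `−½(conj tr X − tr X)X̂·H̄ +
½tr X X̂·H̲̄ = −½conj(tr X)X̂·H̄ + ½tr X X̂·H̄ + ½tr X X̂·H̲̄ = tr X X̂·H̲̄ + ½tr X X̂·H̄`, which gives
`[ᶜ∇₄, 𝒟]tr X = −½tr X 𝒟tr X − tr X B + H̲(𝒟·Ξ̄ + Ξ·H̄ + Ξ̄·H) + (−tr X̲ tr X + 𝒟·H̄ + H·H̄ + 2P)Ξ +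
tr X X̂·H̲̄ + ½tr X X̂·H̄`": from the unsimplified value (`hC0`, brackets abbreviated `r`, `s`, remainder
`q0`) and the CONJUGATE of the quoted Kerr relation, `conj(tr X)H̄ = −tr X H̲̄ + g'` (`hKerr`); the
simplified value differs from the unsimplified one by the quadratic `−½X̂·g'`.
[cite: GiorgiKlainermanSzeftel2024, p0902 L87 – p0903 L16; GiorgiKlainermanSzeftel2022, l.36694–36705] -/
theorem D84_comm_trX_simplified [CharZero K] (Xc : M₁ →ₗ[K] M₁) (x xc r s : K)
    (F Hb Hc Hbc Xi B g' q0 C0 : M₁)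
    (hC0 : C0 = -((1 / 2 * x) • F) - x • B + r • Hb + s • Xi
      - (1 / 2 * (xc - x)) • Xc Hc + (1 / 2 * x) • Xc Hbc + q0)
    (hKerr : xc • Hc = -(x • Hbc) + g') :
    C0 = -((1 / 2 * x) • F) - x • B + r • Hb + s • Xi + x • Xc Hbc + (1 / 2 * x) • Xc Hc
      + (q0 - (1 / 2 : K) • Xc g') := by
  have hX : xc • Xc Hc = -(x • Xc Hbc) + Xc g' := by
    rw [← map_smul, hKerr, map_add, map_neg, map_smul]
  subst hC0
  linear_combination (norm := module) (-(1 / 2 : K)) • hX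

/-- (c) "Applying Lemma 4.2.2, (4.2.12), to `F = 𝒟tr X` and `s = 1`: `[ᶜ∇₄, 𝒟⊗̂]𝒟tr X = −½tr X
𝒟⊗̂𝒟tr X + H̲⊗̂ᶜ∇₄𝒟tr X + Ξ⊗̂ᶜ∇₃𝒟tr X − 2B⊗̂𝒟tr X − tr X̲ Ξ⊗̂𝒟tr X − ½X̂·conj𝒟𝒟tr X + ½X̂(H̲̄·𝒟tr X)
+ ½(X̂·H̲̄)⊗̂𝒟tr X`" (`hC1`; `n4F = ᶜ∇₄𝒟tr X` is kept whole here, `n3 = ᶜ∇₃`, `XDb F = X̂·conj𝒟F`,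
`dHbc F = H̲̄·F`), then "`𝒟(tr X) = −2tr X H̲ + O(ε)`" in the last six slots (`hF`, remainder `gx`):
"`= −½tr X 𝒟⊗̂𝒟tr X + H̲⊗̂ᶜ∇₄𝒟tr X + 4tr X B⊗̂H̲ − 2Ξ⊗̂(ᶜ∇₃(tr X H̲) − tr X tr X̲ H̲) + X̂·conj𝒟(tr X H̲)
− 2tr X(H̲·H̲̄)X̂`".  The LAST coefficient is where the collapse `(X̂·H̲̄)⊗̂H̲ = c(H̲·H̲̄)X̂` (`hcol`) enters:
the kernel value is `−(1 + c)tr X(H̲·H̲̄)X̂` (`½X̂(H̲̄·(−2tr X H̲)) = −tr X(H̲̄·H̲)X̂` directly, plus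
`½(X̂·H̲̄)⊗̂(−2tr X H̲) = −c tr X(H̲·H̲̄)X̂`); PRINTED `−2tr X`, i.e. `c = 1` — `[J]` (2.4.2) as printed gives
`c = 2` (module docstring, PRINT DATUM).  `+` the dropped `gx`-products.
[cite: GiorgiKlainermanSzeftel2024, p0903 L17–78; GiorgiKlainermanSzeftel2022, l.36709–36723] -/
theorem D84_comm_DtrX [CharZero K] (hot : M₁ →ₗ[K] M₁ →ₗ[K] M₂) (Dhat : M₁ →+ M₂)
    (Xc : M₁ →ₗ[K] M₁) (dHbc : M₁ →ₗ[K] K) (n3 : M₁ →+ M₁) (XDb : M₁ →+ M₂)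
    (x xb hh c : K) (F Hb Hbc Xi B n4F gx : M₁) (Xh C1 : M₂)
    (hC1 : C1 = -((1 / 2 * x) • Dhat F) + hot Hb n4F + hot Xi (n3 F) - (2 : K) • hot B F
      - xb • hot Xi F - (1 / 2 : K) • XDb F + (1 / 2 * dHbc F) • Xh + (1 / 2 : K) • hot (Xc Hbc) F)
    (hF : F = -((2 * x) • Hb) + gx) (hhh : dHbc Hb = hh) (hcol : hot (Xc Hbc) Hb = (c * hh) • Xh) :
    C1 = -((1 / 2 * x) • Dhat F) + hot Hb n4F + (4 * x) • hot B Hb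
      - (2 : K) • hot Xi (n3 (x • Hb) - (x * xb) • Hb) + XDb (x • Hb) - ((1 + c) * x * hh) • Xh
      + (hot Xi (n3 gx) - (2 : K) • hot B gx - xb • hot Xi gx - (1 / 2 : K) • XDb gx
        + (1 / 2 * dHbc gx) • Xh + (1 / 2 : K) • hot (Xc Hbc) gx) := by
  have e1 : n3 ((2 * x) • Hb) = (2 : K) • n3 (x • Hb) := by rw [mul_smul, two_smul, map_add, two_smul]
  have e2 : XDb ((2 * x) • Hb) = (2 : K) • XDb (x • Hb) := by rw [mul_smul, two_smul, map_add, two_smul]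
  subst hC1 hF
  simp only [map_add, map_neg, map_sub, map_smul, e1, e2, hhh,
    smul_eq_mul, hcol, smul_add, smul_neg, smul_sub]
  module

/-- (d) "We therefore obtain `ᶜ∇₄𝒜₄ = 𝒟⊗̂𝒟(ᶜ∇₄tr X) + 𝒟⊗̂([ᶜ∇₄, 𝒟]tr X) + 4H̲⊗̂[ᶜ∇₄, 𝒟]tr X −
½tr X 𝒟⊗̂𝒟tr X + 4H̲⊗̂𝒟ᶜ∇₄tr X + 3ᶜ∇₄H̲⊗̂𝒟(tr X) + 4tr X B⊗̂H̲ − 2Ξ⊗̂(ᶜ∇₃(tr X H̲) − tr X tr X̲ H̲) +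
X̂·conj𝒟(tr X H̲) − 2tr X(H̲·H̲̄)X̂`" — from (a) (`hN`, with `DD4x = 𝒟ᶜ∇₄tr X`, `n4Hb = ᶜ∇₄H̲`) and
(c) (`hC1`, with `ᶜ∇₄𝒟tr X = 𝒟ᶜ∇₄tr X + [ᶜ∇₄, 𝒟]tr X` inserted and the collapse coefficient `c`;
`3 + 1 = 4` twice).  Printed: `c = 1`.
[cite: GiorgiKlainermanSzeftel2024, p0903 L79–102; GiorgiKlainermanSzeftel2022, l.36727–36733] -/
theorem D84_collect [CharZero K] (hot : M₁ →ₗ[K] M₁ →ₗ[K] M₂) (Dhat : M₁ →+ M₂) (XDb : M₁ →+ M₂)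
    (n3 : M₁ →+ M₁) (x xb hh c : K) (F Hb Xi B DD4x C0 n4Hb : M₁) (N C1 Qc Xh : M₂)
    (hN : N = Dhat DD4x + Dhat C0 + C1 + (3 : K) • hot n4Hb F + (3 : K) • hot Hb DD4x
      + (3 : K) • hot Hb C0)
    (hC1 : C1 = -((1 / 2 * x) • Dhat F) + hot Hb (DD4x + C0) + (4 * x) • hot B Hb
      - (2 : K) • hot Xi (n3 (x • Hb) - (x * xb) • Hb) + XDb (x • Hb) - ((1 + c) * x * hh) • Xh + Qc) :
    N = Dhat DD4x + Dhat C0 + (4 : K) • hot Hb C0 - (1 / 2 * x) • Dhat F + (4 : K) • hot Hb DD4x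
      + (3 : K) • hot n4Hb F + (4 * x) • hot B Hb - (2 : K) • hot Xi (n3 (x • Hb) - (x * xb) • Hb)
      + XDb (x • Hb) - ((1 + c) * x * hh) • Xh + Qc := by
  subst hN hC1
  simp only [map_add]
  module

/-- (e) "Using the Ricci identity `ᶜ∇₄tr X = −½(tr X)² + 𝒟·Ξ̄ + Ξ·H̄ + Ξ̄·H + O(ε²)` we compute
`𝒟(ᶜ∇₄tr X) = −(tr X)𝒟tr X + 𝒟𝒟·Ξ̄ + 𝒟Ξ·H̄ + 𝒟Ξ̄·H + Ξ𝒟·H̄ + Ξ̄𝒟·H` and `𝒟⊗̂𝒟(ᶜ∇₄tr X) =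
−(tr X)𝒟⊗̂𝒟tr X − 𝒟(tr X)⊗̂𝒟tr X + 𝒟⊗̂𝒟𝒟·Ξ̄ + 𝒟⊗̂(𝒟Ξ·H̄ + 𝒟Ξ̄·H + Ξ𝒟·H̄ + Ξ̄𝒟·H)`" — with `𝒟` a
derivation on scalars (`Dc`, `Dc x = F`), the Leibniz rule of `𝒟⊗̂` (`hDL`) and the Ricci identity as a
hypothesis on `D4 x` (`h4x`, remainder `e4`); the kernel keeps `𝒟(Ξ·H̄)`, `𝒟(Ξ̄·H)` whole (READING
NOTE (3)).
[cite: GiorgiKlainermanSzeftel2024, p0904 L5–48; GiorgiKlainermanSzeftel2022, l.36736–36749] -/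
theorem D84_DD4 [CharZero K] {D4 : Derivation ℤ K K} (Dc : Derivation ℤ K M₁)
    (hot : M₁ →ₗ[K] M₁ →ₗ[K] M₂) (Dhat : M₁ →+ M₂) (x divXic XiHc XicH e4 : K) (F : M₁)
    (hDL : ∀ (f : K) (u : M₁), Dhat (f • u) = f • Dhat u + hot (Dc f) u)
    (hFx : Dc x = F) (h4x : D4 x = -(1 / 2) * x ^ 2 + (divXic + XiHc + XicH) + e4) :
    Dc (D4 x) = -(x • F) + (Dc divXic + Dc XiHc + Dc XicH + Dc e4) ∧
    Dhat (Dc (D4 x)) = -(x • Dhat F) - hot F F + Dhat (Dc divXic + Dc XiHc + Dc XicH + Dc e4) := by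
  obtain ⟨-, -, -, -, h12, -, -⟩ := Dm_num Dc
  have hD : Dc (D4 x) = -(x • F) + (Dc divXic + Dc XiHc + Dc XicH + Dc e4) := by
    rw [h4x]
    simp only [map_add, map_neg, Dc.leibniz, pow_two, hFx, h12, smul_zero, add_zero, neg_mul,
      smul_add]
    module
  refine ⟨hD, ?_⟩
  rw [hD]
  simp only [map_add, map_neg, hDL, hFx]
  module

/-- (f) "Also, using the above we compute `𝒟⊗̂([ᶜ∇₄, 𝒟]tr X) = −½tr X 𝒟⊗̂𝒟tr X − ½𝒟(tr X)⊗̂𝒟tr X −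
tr X 𝒟⊗̂B − 𝒟(tr X)⊗̂B − ½(conj tr X − tr X)𝒟⊗̂(X̂·H̄) + ½tr X 𝒟⊗̂(X̂·H̲̄) − ½𝒟(conj tr X − tr X)⊗̂X̂·H̄
+ ½𝒟(tr X)⊗̂X̂·H̲̄`" and, "using that `𝒟(tr X) = −2tr X H̲ + O(ε)`, `𝒟(conj tr X) = (tr X − conj tr X)H
+ O(ε)`" (`hF`, `hxc`, remainders `gx`, `gxc`), "`= −½tr X 𝒟⊗̂𝒟tr X − ½𝒟(tr X)⊗̂𝒟tr X − tr X 𝒟⊗̂B +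
2tr X H̲⊗̂B − ½(conj tr X − tr X)𝒟⊗̂(X̂·H̄) + ½tr X 𝒟⊗̂(X̂·H̲̄) − ½((tr X − conj tr X)H + 2tr X H̲)⊗̂X̂·H̄ −
tr X H̲⊗̂X̂·H̲̄`" — from the UNSIMPLIFIED value of the commutator (`hC0`, brackets `r = 𝒟·Ξ̄ + Ξ·H̄ +
Ξ̄·H`, `s = −tr X̲ tr X + 𝒟·H̄ + H·H̄ + 2P`, remainder `q0`) and the Leibniz rule (`hDL`); the kernel
carries the `Ξ`-terms `𝒟⊗̂(rH̲) + 𝒟⊗̂(sΞ)` the display omits (READING NOTE (1)) `+` the dropped products.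
[cite: GiorgiKlainermanSzeftel2024, p0904 L49–123; GiorgiKlainermanSzeftel2022, l.36752–36765] -/
theorem D84_Dhat_comm [CharZero K] (Dc : Derivation ℤ K M₁) (hot : M₁ →ₗ[K] M₁ →ₗ[K] M₂)
    (Dhat : M₁ →+ M₂) (Xc : M₁ →ₗ[K] M₁) (x xc r s : K) (F Hb H Hc Hbc Xi B gx gxc q0 C0 : M₁)
    (hDL : ∀ (f : K) (u : M₁), Dhat (f • u) = f • Dhat u + hot (Dc f) u)
    (hC0 : C0 = -((1 / 2 * x) • F) - x • B + r • Hb + s • Xi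
      - (1 / 2 * (xc - x)) • Xc Hc + (1 / 2 * x) • Xc Hbc + q0)
    (hFx : Dc x = F) (hF : F = -((2 * x) • Hb) + gx) (hxc : Dc xc = (x - xc) • H + gxc) :
    Dhat C0 = -((1 / 2 * x) • Dhat F) - (1 / 2 : K) • hot F F - x • Dhat B + (2 * x) • hot Hb B
      - (1 / 2 * (xc - x)) • Dhat (Xc Hc) + (1 / 2 * x) • Dhat (Xc Hbc)
      - (1 / 2 : K) • hot ((x - xc) • H + (2 * x) • Hb) (Xc Hc) - x • hot Hb (Xc Hbc)
      + (Dhat (r • Hb) + Dhat (s • Xi))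
      + (Dhat q0 - hot gx B - (1 / 2 : K) • hot (gxc - gx) (Xc Hc) + (1 / 2 : K) • hot gx (Xc Hbc)) := by
  obtain ⟨h2, -, -, -, h12, -, -⟩ := Dm_num Dc
  subst hC0 hF
  simp only [map_add, map_sub, map_neg, hDL, Dc.leibniz, hFx, hxc, h12, h2, smul_zero, add_zero,
    LinearMap.add_apply, LinearMap.sub_apply, LinearMap.neg_apply,
    LinearMap.smul_apply, map_smul, smul_add, smul_sub, smul_neg]
  module

/-- (g) "We finally put all together": from (d) (`hN`), (e) (`hDD1`, `hDD2`, with `Dcr = 𝒟𝒟·Ξ̄ +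
𝒟(Ξ·H̄) + 𝒟(Ξ̄·H)` (+ `𝒟e4`)), (f) (`hf`, its dropped products abbreviated `Qf`), the SIMPLIFIED value
of the commutator inside `4H̲⊗̂[ᶜ∇₄, 𝒟]tr X` (`hC0`, READING NOTE (2)), the definitions of `𝒜₄, 𝒜₃`,
the step "`−(3/2)(𝒟tr X − 2ᶜ∇₄H̲)⊗̂𝒟tr X = (3/2)𝒜₃⊗̂𝒟tr X = −3tr X H̲⊗̂𝒜₃ + …`" (`hA3F`: `𝒟tr X =
−2tr X H̲` in that slot and `⊗̂` symmetric, remainder `qA`), the silent flip `B⊗̂H̲ = H̲⊗̂B` (`hsB`), and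
the collapses `H̲⊗̂(X̂·H̲̄) = c(H̲·H̲̄)X̂`, `H⊗̂(X̂·H̄) = c(H·H̄)X̂` (`hcol1`, `hcol2`).  `𝓜[Ξ]` is the
EXPLICIT sum `hM` of the `Ξ`-carrying terms: `𝒟⊗̂Dcr + 4H̲⊗̂Dcr + 𝒟⊗̂(rH̲) + 𝒟⊗̂(sΞ) + 4rH̲⊗̂H̲ +
4sH̲⊗̂Ξ − 2Ξ⊗̂(ᶜ∇₃(tr X H̲) − tr X tr X̲ H̲)` (each carries `Ξ`, `Ξ̄` or `𝒟·Ξ̄` through `r`, `s·Ξ`, `Dcr`).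
Conclusion: the statement of Lemma D.8.4 with the collapse-dependent coefficients `(2c − 1)tr X
(H̲·H̲̄)X̂` and `−½(tr X − conj tr X)c(H·H̄)X̂` — PRINTED `tr X(H̲·H̲̄)X̂`, `−½(tr X − conj tr X)(H·H̄)X̂`,
i.e. `c = 1`; `[J]` (2.4.2) as printed gives `c = 2` (module docstring, PRINT DATUM) — `+` the dropped
products `Qc + Qf + 4H̲⊗̂q0 + (3/2)qA`.  The other coefficients as printed: `𝒟⊗̂𝒟tr X: −1 − ½ − ½ =
−2 = −2·𝒜₄-part`, `H̲⊗̂𝒟tr X: −2 − 4 = −6`, `H̲⊗̂B: 2 − 4 + 4 = 2`, `H̲⊗̂X̂·H̄: −1 + 2 = 1`.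
[cite: GiorgiKlainermanSzeftel2024, p0901 L111–135, p0905 L5–99; GiorgiKlainermanSzeftel2022, l.36661–36668, l.36766–36789] -/
theorem D84_final [CharZero K] (hot : M₁ →ₗ[K] M₁ →ₗ[K] M₂) (Dhat : M₁ →+ M₂) (Xc : M₁ →ₗ[K] M₁)
    (XDb : M₁ →+ M₂) (n3 : M₁ →+ M₁) (x xc xb r s hh HHc c : K)
    (F Hb H Hc Hbc Xi B DD4x Dcr C0 n4Hb A3 q0 : M₁) (N A4 Xh Qc Qf qA MXi : M₂)
    (hN : N = Dhat DD4x + Dhat C0 + (4 : K) • hot Hb C0 - (1 / 2 * x) • Dhat F + (4 : K) • hot Hb DD4x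
      + (3 : K) • hot n4Hb F + (4 * x) • hot B Hb - (2 : K) • hot Xi (n3 (x • Hb) - (x * xb) • Hb)
      + XDb (x • Hb) - ((1 + c) * x * hh) • Xh + Qc)
    (hDD1 : DD4x = -(x • F) + Dcr) (hDD2 : Dhat DD4x = -(x • Dhat F) - hot F F + Dhat Dcr)
    (hf : Dhat C0 = -((1 / 2 * x) • Dhat F) - (1 / 2 : K) • hot F F - x • Dhat B + (2 * x) • hot Hb B
      - (1 / 2 * (xc - x)) • Dhat (Xc Hc) + (1 / 2 * x) • Dhat (Xc Hbc)
      - (1 / 2 : K) • hot ((x - xc) • H + (2 * x) • Hb) (Xc Hc) - x • hot Hb (Xc Hbc)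
      + (Dhat (r • Hb) + Dhat (s • Xi)) + Qf)
    (hC0 : C0 = -((1 / 2 * x) • F) - x • B + r • Hb + s • Xi + x • Xc Hbc + (1 / 2 * x) • Xc Hc + q0)
    (hA4 : A4 = Dhat F + (3 : K) • hot Hb F) (hA3 : A3 = (2 : K) • n4Hb - F)
    (hA3F : hot A3 F = -((2 * x) • hot Hb A3) + qA)
    (hcol1 : hot Hb (Xc Hbc) = (c * hh) • Xh) (hcol2 : hot H (Xc Hc) = (c * HHc) • Xh)
    (hsB : hot B Hb = hot Hb B)
    (hM : MXi = Dhat Dcr + (4 : K) • hot Hb Dcr + Dhat (r • Hb) + Dhat (s • Xi) + (4 * r) • hot Hb Hb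
      + (4 * s) • hot Hb Xi - (2 : K) • hot Xi (n3 (x • Hb) - (x * xb) • Hb)) :
    N = -((2 * x) • A4) - (3 * x) • hot Hb A3 - x • Dhat B + (2 * x) • hot Hb B + MXi
      - (1 / 2 * (xc - x)) • Dhat (Xc Hc) + (1 / 2 * x) • Dhat (Xc Hbc)
      - (1 / 2 * (x - xc) * (c * HHc)) • Xh + ((2 * c - 1) * x * hh) • Xh
      + x • hot Hb (Xc Hc) + XDb (x • Hb)
      + (Qc + Qf + (4 : K) • hot Hb q0 + (3 / 2 : K) • qA) := by
  have hA3h : hot A3 F = hot ((2 : K) • n4Hb - F) F := by rw [hA3]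
  rw [hf, hDD2] at hN
  subst hN hDD1 hC0 hA4 hM
  simp only [map_add, map_sub, map_neg, map_smul, LinearMap.add_apply, LinearMap.sub_apply,
    LinearMap.smul_apply, hcol1, hcol2, hsB, smul_add, smul_sub, smul_neg] at hA3h ⊢
  linear_combination (norm := module) (3 / 2 : K) • hA3F - (3 / 2 : K) • hA3h

/-! ## §4 Lemma D.8.5 (`[v1]` Lemma `derivatives-nabc4-BB`) -/

/-- Lemma D.8.5, first identity, EXACT.  Entering: the definition of `ℬ` (`hbb`, `Ddot = 𝒟·`,
`pair Hb Bc = H̲·B̄`); "`ᶜ∇₄ℬ = 𝒟·(ᶜ∇₄B̄) + [ᶜ∇₄, 𝒟·]B̄ + 2H̲·ᶜ∇₄B̄ + 2ᶜ∇₄H̲·B̄`" (the product rule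
`hLeib` for `ᶜ∇₄(H̲·B̄)`); "From Lemma 4.2.2, (4.2.16), applied to `F = B` and `s = 1`: `[ᶜ∇₄, 𝒟·]B̄ =
−½tr X(𝒟·B̄ − 2H̲·B̄) + H̲·ᶜ∇₄B̄`" (`hcomm`, err-version remainder `gcm`; the display prints `F̄` for the
second `B̄`); "the Bianchi identity `ᶜ∇₄B̄ + 2tr X B̄ = 3PΞ̄ + ½(𝒟·Ā + Ā·H̲)`" (`hBianchi`, `W = 𝒟·Ā +
Ā·H̲`); the Leibniz rule of `𝒟·` (`hDdL`, displayed as "`−2tr X 𝒟·B̄ − 2𝒟tr X·B̄ + 3P𝒟·Ξ̄ + 3𝒟P·Ξ̄ +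
½𝒟·(…)`"); "`𝒟(tr X) = −2tr X H̲ + O(ε)`, `ᶜ∇₄(H̲) = −tr X H̲ + O(ε)`, `𝒟P = −3H̲P + O(ε)`" (`hDx`, `h4Hb`,
`hDP`, remainders `gx`, `g4`, `gP`).  Conclusion = the displayed "`ᶜ∇₄ℬ = −(5/2)tr X 𝒟·B̄ − 3tr X H̲·B̄ +
3P𝒟·Ξ̄ + ½(𝒟 + 3H̲)·(𝒟·Ā + Ā·H̲)`" rewritten, "writing `𝒟·B̄ = ℬ − 2H̲·B̄`", as the printed "`ᶜ∇₄ℬ =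
−(5/2)tr X ℬ + 2tr X H̲·B̄ + 3P𝒟·Ξ̄ + ½(𝒟 + 3H̲)·(𝒟·Ā + Ā·H̲)`" (the `9PH̲·Ξ̄` cancel), `+` the dropped
products.
[cite: GiorgiKlainermanSzeftel2024, p0905 L100–109, p0906 L32 – p0907 L19; GiorgiKlainermanSzeftel2022, l.36793–36796, l.36809–36841] -/
theorem D85_nab4_B [CharZero K] {D4 : Derivation ℤ K K} (N4 : CovD D4 M₁) (Dc : Derivation ℤ K M₁)
    (Ddot : M₁ →+ K) (pair : M₁ →ₗ[K] M₁ →ₗ[K] K) (x p bb gcm : K) (Hb Bc Xic W gx g4 gP : M₁)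
    (hbb : bb = Ddot Bc + 2 * pair Hb Bc)
    (hLeib : D4 (pair Hb Bc) = pair (N4.op Hb) Bc + pair Hb (N4.op Bc))
    (hcomm : D4 (Ddot Bc) = Ddot (N4.op Bc) - 1 / 2 * x * (Ddot Bc - 2 * pair Hb Bc)
      + pair Hb (N4.op Bc) + gcm)
    (hBianchi : N4.op Bc = -((2 * x) • Bc) + (3 * p) • Xic + (1 / 2 : K) • W)
    (hDdL : ∀ (f : K) (u : M₁), Ddot (f • u) = f * Ddot u + pair (Dc f) u)
    (hDx : Dc x = -((2 * x) • Hb) + gx) (h4Hb : N4.op Hb = -(x • Hb) + g4)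
    (hDP : Dc p = -((3 * p) • Hb) + gP) :
    D4 bb = -(5 / 2 * x * bb) + 2 * x * pair Hb Bc + 3 * p * Ddot Xic
      + (1 / 2 * Ddot W + 3 / 2 * pair Hb W)
      + (-(2 * pair gx Bc) + 2 * pair g4 Bc + 3 * pair gP Xic + gcm) := by
  obtain ⟨h2, h3, -, -, h12, -, -⟩ := Dm_num Dc
  obtain ⟨e2, -, -, -, -, -, -⟩ := Dm_num D4
  subst hbb
  rw [map_add, hcomm, D4.leibniz, hLeib, e2, hBianchi, h4Hb]
  simp only [map_add, map_neg, map_smul, hDdL, Dc.leibniz, h2, h3, h12, hDx, hDP, smul_zero, add_zero,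
    map_zero, LinearMap.zero_apply, LinearMap.add_apply, LinearMap.neg_apply, LinearMap.smul_apply,
    smul_eq_mul, mul_zero]
  ring

/-- Lemma D.8.5, second identity, EXACT.  Entering: "Applying Lemma 4.2.2, (4.2.10), to `h = ℬ` and
`s = 1` we have, up to quadratic terms `[ᶜ∇₄, 𝒟]ℬ = −½tr X 𝒟ℬ + H̲ᶜ∇₄ℬ + ½tr X H̲ℬ`" (`hcomm`,
entered as `−½tr X(𝒟ℬ − ℬH̲) + ᶜ∇₄ℬ H̲ + gc`, err-version remainder `gc`), the first
identity with `w = ½(𝒟 + 3H̲)·(𝒟·Ā + Ā·H̲)` (`hi`), `𝒟` a derivation on scalars ("Using Lemma 2.4.6":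
`𝒟(tr X ℬ) = tr X 𝒟ℬ + ℬ𝒟tr X`, …), the displayed expansion "`𝒟(H̲·B̄) = (𝒟H̲)·B̄ + H̲(𝒟·B̄)`"
(`hLHB`, `DHbB = (𝒟H̲)·B̄`, `divBc = 𝒟·B̄`), "`(𝒟H̲)·B̄ = −H̲(H̲·B̄) + O(ε)`" (`hDHbB`, remainder `gH`), "`𝒟·B̄ =
ℬ − 2H̲·B̄`" (`hdiv`), and `𝒟tr X = −2tr X H̲ + gx`, `𝒟P = −3H̲P + gP`.  Conclusion = the displayed chain
ending in the printed "`ᶜ∇₄𝒟ℬ = −3tr X 𝒟ℬ + 5tr X H̲ℬ − 8tr X H̲(H̲·B̄) + 3P𝒟𝒟·Ξ̄ − 6H̲P𝒟·Ξ̄ +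
½(𝒟 + H̲)((𝒟 + 3H̲)·(𝒟·Ā + Ā·H̲))`" (last term = `𝒟w + wH̲`), `+` the dropped products
(`𝒟ℬ: −(5/2) − ½ = −3`; `H̲ℬ: 5 + 2 + ½ − (5/2) = 5`; `H̲(H̲·B̄): −2 − 4 − 4 + 2 = −8`; `H̲P𝒟·Ξ̄: −9 + 3 = −6`).
[cite: GiorgiKlainermanSzeftel2024, p0905 L110–119, p0907 L20–91; GiorgiKlainermanSzeftel2022, l.36797–36799, l.36845–36868] -/
theorem D85_nab4_DB [CharZero K] {D4 : Derivation ℤ K K} (N4 : CovD D4 M₁) (Dc : Derivation ℤ K M₁)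
    (x p bb HbBc divBc divXic w : K) (Hb DHbB gx gP gH gc : M₁)
    (hcomm : N4.op (Dc bb) = Dc (D4 bb) - (1 / 2 * x) • (Dc bb - bb • Hb) + D4 bb • Hb + gc)
    (hi : D4 bb = -(5 / 2 * x * bb) + 2 * x * HbBc + 3 * p * divXic + w)
    (hLHB : Dc HbBc = DHbB + divBc • Hb) (hDHbB : DHbB = -(HbBc • Hb) + gH)
    (hdiv : divBc = bb - 2 * HbBc)
    (hDx : Dc x = -((2 * x) • Hb) + gx) (hDP : Dc p = -((3 * p) • Hb) + gP) :
    N4.op (Dc bb) = -((3 * x) • Dc bb) + (5 * x * bb) • Hb - (8 * x * HbBc) • Hb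
      + (3 * p) • Dc divXic - (6 * p * divXic) • Hb + (Dc w + w • Hb)
      + (-((5 / 2 * bb) • gx) + (2 * x) • gH + (2 * HbBc) • gx + (3 * divXic) • gP + gc) := by
  obtain ⟨h2, h3, -, -, -, -, h52⟩ := Dm_num Dc
  subst hDHbB hdiv
  rw [hcomm, hi]
  simp only [map_add, map_neg, Dc.leibniz, hLHB, hDx, hDP, h2, h3, h52, smul_zero, add_zero,
    smul_add, smul_sub, smul_neg]
  module

/-- Lemma D.8.5, third identity, EXACT.  Entering: "Applying Lemma 4.2.2, (4.2.13), to `F = 𝒟ℬ` and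
`s = 1`: `[ᶜ∇₄, 𝒟⊗̂]𝒟ℬ = −½tr X 𝒟⊗̂𝒟ℬ + H̲⊗̂ᶜ∇₄𝒟ℬ`" (`hcomm`, remainder `g₄`), the second identity
with its bracket `Z = −8tr X H̲(H̲·B̄) + 3P𝒟𝒟·Ξ̄ − 6H̲P𝒟·Ξ̄` and its `Expr`-term `E = ½(𝒟 + H̲)(…)` kept
whole (`hii`; `DB = 𝒟ℬ`), the Leibniz rule of `𝒟⊗̂` (`hDL`; "`5𝒟tr X⊗̂H̲ℬ + 5tr X 𝒟⊗̂H̲ ℬ + 5tr X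
H̲⊗̂𝒟ℬ`"), `𝒟tr X = −2tr X H̲ + gx`, "`𝒟⊗̂H̲ = −H̲⊗̂H̲ + O(ε)`" entered EXACTLY as `𝒟⊗̂H̲ = −H̲⊗̂H̲ + 𝒜₂`
(`hA2`), and the silent flip `𝒟ℬ⊗̂H̲ = H̲⊗̂𝒟ℬ` (`hs`).  Conclusion = the printed "`ᶜ∇₄𝒟⊗̂𝒟ℬ = −(7/2)tr X
𝒟⊗̂𝒟ℬ + 8tr X H̲⊗̂𝒟ℬ − 10tr X H̲⊗̂H̲ℬ + (𝒟 + H̲)⊗̂[Z] + Expr₁(A)`" with `Expr₁(A) = ½(𝒟 + H̲)⊗̂((𝒟 +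
H̲)(…)) = 𝒟⊗̂E + H̲⊗̂E`, `+` the dropped products `−3gx⊗̂𝒟ℬ + 5ℬgx⊗̂H̲ + 5tr X ℬ𝒜₂ + g₄`
(`𝒟⊗̂𝒟ℬ: −3 − ½ = −7/2`; `H̲⊗̂𝒟ℬ: 6 + 5 − 3 = 8`; `H̲⊗̂H̲ℬ: −10 − 5 + 5 = −10`).
[cite: GiorgiKlainermanSzeftel2024, p0906 L5–31, p0908 L5–117; GiorgiKlainermanSzeftel2022, l.36800–36807, l.36872–36903] -/
theorem D85_nab4_DhatDB [CharZero K] {D4 : Derivation ℤ K K} (N4 : CovD D4 M₁) (N4' : CovD D4 M₂)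
    (Dc : Derivation ℤ K M₁) (hot : M₁ →ₗ[K] M₁ →ₗ[K] M₂) (Dhat : M₁ →+ M₂)
    (x bb : K) (Hb DB Z E gx : M₁) (A2 g₄ : M₂)
    (hDL : ∀ (f : K) (u : M₁), Dhat (f • u) = f • Dhat u + hot (Dc f) u)
    (hcomm : N4'.op (Dhat DB) = Dhat (N4.op DB) - (1 / 2 * x) • Dhat DB + hot Hb (N4.op DB) + g₄)
    (hii : N4.op DB = -((3 * x) • DB) + (5 * x * bb) • Hb + Z + E)
    (hDB : Dc bb = DB) (hDx : Dc x = -((2 * x) • Hb) + gx) (hA2 : A2 = Dhat Hb + hot Hb Hb)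
    (hs : hot DB Hb = hot Hb DB) :
    N4'.op (Dhat DB) = -((7 / 2 * x) • Dhat DB) + (8 * x) • hot Hb DB - (10 * x * bb) • hot Hb Hb
      + (Dhat Z + hot Hb Z) + (Dhat E + hot Hb E)
      + (-((3 : K) • hot gx DB) + (5 * bb) • hot gx Hb + (5 * x * bb) • A2 + g₄) := by
  obtain ⟨-, h3, -, h5, -, -, -⟩ := Dm_num Dc
  have hDh : Dhat Hb = -hot Hb Hb + A2 := by rw [hA2]; abel
  rw [hcomm, hii]
  simp only [map_add, map_neg, hDL, Dc.leibniz, hDB, hDx, h3, h5, smul_zero, add_zero,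
    LinearMap.add_apply, LinearMap.neg_apply, LinearMap.smul_apply, map_smul, hDh, hs,
    smul_add, smul_neg]
  module

end Literature.Geometry.Lorentzian.GiorgiKlainermanSzeftel2022.TeukolskyStarobinskiPrelimLedger
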